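import Literature.Analysis.FluidPDE.PeriodicCylinderHelmholtz
import Literature.Analysis.FluidPDE.PeriodicCylinderInteriorWords
import Literature.Analysis.Calculus.SeeleyExtension
import HarnessLib

/-!
# A smooth periodic extension operator across the wall of the periodic cylinder
# (radial Seeley reflection)

Analysis/FluidPDE support file for the Kato–Lai local existence theory in the periodic cylinder
`{r ≤ 1} × ℝ/Lℤ` (`Literature.Analysis.FluidPDE.KatoLai1984_periodicCylinderUniformExistence`,
Kato–Lai 1984, Thm I/II): the energy method is run on a flat torus containing the period cell,
and functions smooth on the closed cylinder are transported there by a **linear extension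
operator which is smooth-valued, `L`-periodic in `z`, and bounded on every Sobolev space
`H^k` simultaneously** (Kato–Lai 1984, §7, (7.1): "`R` is a linear operator of extension of
`H^s(Ω)` into `H^s(ℝ^m)` such that it is bounded on `H^s(Ω)` to `H^s(ℝ^m)` for `0 ≤ s ≤ s₁`.
(It is well known that such an operator exists.)"). This file constructs the operator and proves
its qualitative properties; the Sobolev bounds are proved in the sequel
`PeriodicCylinderExtensionBounds.lean`.

The construction is R. T. Seeley's reflection (*Extension of `C^∞` functions defined in a half
space*, Proc. AMS 15 (1964) 625–626), in the tree as `Literature.Analysis.Calculus.Seeley.extend`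
with `Seeley.contDiffOn_extend` (smoothness across the hyperplane `{t = 0}` of `ℝ × E'`), applied
in the **radial variable**: with the collar chart `Φ(t, y) = (1 - t) y_h/|y_h| + y_v`
(`collarChart`; `y_h` the horizontal and `y_v` the vertical part of `y`), a function `f` smooth
on the closed cylinder gives `g = f ∘ Φ`, smooth on the slab `[0, 1/2) × {|y_h| > 1/2}` (there
`Φ(t, y)` has radius `1 - t ≤ 1`); Seeley's `E g` is smooth on `(-∞, 1/2) × {|y_h| > 1/2}`, and
`x ↦ E g (1 - |x_h|, x)` is a smooth function on `{|x_h| > 1/2}` which equals `f` on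
`{1/2 < |x_h| ≤ 1}` (`Φ(1 - |x_h|, x) = x`). Glued with `f` inside and cut off radially:

* `PeriodicCylinder.rawExtend f`, `PeriodicCylinder.cylExtend f = χ · rawExtend f` with the
  radial cutoff `χ = cylRadialCutoff (9/8) (5/4)` (`= 1` on `{r ≤ 9/8}`, `= 0` on `{r ≥ 5/4}`);
* `contDiff_cylExtend` — `cylExtend f` is `C^∞` on `ℝ³` if `f` is `C^∞` on the closed cylinder;
  `cylExtend_of_le_one` — `cylExtend f = f` on the closed cylinder; `cylExtend_eq_zero` — it
  vanishes on `{r ≥ 5/4}`; `isAxiallyPeriodic_cylExtend` — it is `L`-periodic in `z` if `f` is;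
  `cylExtend_add`, `cylExtend_smul` — linearity;
* the **reflection formula** on the collar `{r > 1}` (`rawExtend_of_one_lt`,
  `rawExtend_eq_sum`): `rawExtend f x = ∑_k w_k(1 - r) f(R_k x)` with Seeley's weights
  `w_k = Seeley.weight (1/2) k` and the radial reflections
  `R_k x = (1 - 2^k (r - 1)) x_h / r + x_v` (`radialReflect`), a finite sum on every
  `{r ≥ 1 + η}`, `η > 0` — the form in which the Sobolev bounds are proved in the sequel.

Everything is proved; no named fact and no `sorry` is introduced.

## Mathlib / tree search

Tree: `Seeley.extend`, `Seeley.term`, `Seeley.weight`, `Seeley.contDiffOn_extend`,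
`Seeley.extend_eq_sum_of_lt`, `Seeley.weight_eq_zero` (`Calculus/SeeleyExtension`);
`cylRadius`, `horizontalProj(L)`, `closure_unitCylinder`, `contDiffAt_cylRadius` is in
`SwirlCutoff` (heavy imports) and is re-derived here in two lines from `Real.sqrt`;
`cylRadialCutoff` (`PeriodicCylinderInteriorWords`); `IsSmoothPeriodic` (`PeriodicCylinderHelmholtz`).
`lean search 'cylExtend|radialReflect|Seeley.*cylinder'`: nothing prior; the tree's Stein
extension (`FunctionSpaces.stein_extension_holds`) is `k`-dependent and not smooth-valued, which is
why Seeley's operator is used.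

## References

* R. T. Seeley, *Extension of `C^∞` functions defined in a half space*, Proc. Amer. Math. Soc. 15
  (1964) 625–626. [Seeley1964]
* T. Kato, C. Y. Lai, *Nonlinear evolution equations and the Euler flow*, J. Funct. Anal. 56
  (1984) 15–28, §7, (7.1). [KatoLai1984]
-/

noncomputable section

open MeasureTheory Set Function Filter Topology TopologicalSpace WithLp Finset
open scoped ContDiff NNReal ENNReal InnerProductSpace RealInnerProductSpace

namespace Literature.Analysis.FluidPDE

open Literature.Analysis.Calculus

/-- Local notation for physical space `ℝ³ = EuclideanSpace ℝ (Fin 3)`. -/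
local notation "ℝ³" => EuclideanSpace ℝ (Fin 3)

/-- Local notation for the closed unit cylinder `{r ≤ 1}`. -/
local notation "𝕂" => closure (SetLike.coe unitCylinder : Set (EuclideanSpace ℝ (Fin 3)))

namespace PeriodicCylinder

variable {F : Type*} [NormedAddCommGroup F] [NormedSpace ℝ F]
variable {L : ℝ}

/-! ### Smoothness of the radius off the axis -/

/-- The cylindrical radius is `C^∞` off the axis (square root of a positive smooth function).
[folklore] -/
theorem contDiffAt_cylRadius' {y : ℝ³} (hy : cylRadius y ≠ 0) {n : WithTop ℕ∞} :
    ContDiffAt ℝ n cylRadius y := by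
  have h0 : ContDiff ℝ n (fun y : ℝ³ => y 0 ^ 2 + y 1 ^ 2) :=
    (((EuclideanSpace.proj (0 : Fin 3) : ℝ³ →L[ℝ] ℝ).contDiff).pow 2).add
      (((EuclideanSpace.proj (1 : Fin 3) : ℝ³ →L[ℝ] ℝ).contDiff).pow 2)
  have hne : y 0 ^ 2 + y 1 ^ 2 ≠ 0 := by
    intro h
    apply hy
    rw [cylRadius, h, Real.sqrt_zero]
  exact h0.contDiffAt.sqrt hne

/-- The axial shift vector `L e₂`. -/
local notation "𝐯" L':max => (L' : ℝ) • EuclideanSpace.single (2 : Fin 3) (1 : ℝ)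

/-! ### The collar chart -/

/-- **The collar chart** `Φ(t, y) = (1 - t) y_h / |y_h| + y_v`: the point at radius `1 - t` on
the ray of `y` (same angle and height). For `t ∈ [0, 1/2)` and `|y_h| > 1/2` it lies in the closed
cylinder; `Φ(1 - |x_h|, x) = x`. [cite: Seeley1964, Theorem] -/
def collarChart (p : ℝ × ℝ³) : ℝ³ :=
  ((1 - p.1) * (cylRadius p.2)⁻¹) • horizontalProjL p.2 + (p.2 - horizontalProjL p.2)

/-- Coordinates of the collar chart. [folklore] -/
theorem collarChart_apply_zero (p : ℝ × ℝ³) :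
    collarChart p 0 = (1 - p.1) * (cylRadius p.2)⁻¹ * p.2 0 := by
  simp [collarChart]

/-- Coordinates of the collar chart. [folklore] -/
theorem collarChart_apply_one (p : ℝ × ℝ³) :
    collarChart p 1 = (1 - p.1) * (cylRadius p.2)⁻¹ * p.2 1 := by
  simp [collarChart]

/-- Coordinates of the collar chart: the height is unchanged. [folklore] -/
theorem collarChart_apply_two (p : ℝ × ℝ³) : collarChart p 2 = p.2 2 := by
  simp [collarChart]

/-- The radius of `Φ(t, y)` is `|1 - t|` (off the axis). [folklore] -/
theorem cylRadius_collarChart {p : ℝ × ℝ³} (hp : cylRadius p.2 ≠ 0) :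
    cylRadius (collarChart p) = |1 - p.1| := by
  have hr : cylRadius p.2 ^ 2 = p.2 0 ^ 2 + p.2 1 ^ 2 := cylRadius_sq p.2
  rw [cylRadius, collarChart_apply_zero, collarChart_apply_one]
  have : ((1 - p.1) * (cylRadius p.2)⁻¹ * p.2 0) ^ 2 + ((1 - p.1) * (cylRadius p.2)⁻¹ * p.2 1) ^ 2
      = (1 - p.1) ^ 2 := by
    have h1 : (cylRadius p.2)⁻¹ ^ 2 * (p.2 0 ^ 2 + p.2 1 ^ 2) = 1 := by
      rw [← hr, ← mul_pow, inv_mul_cancel₀ hp, one_pow]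
    linear_combination (1 - p.1) ^ 2 * h1
  rw [this, Real.sqrt_sq_eq_abs]

/-- `Φ(1 - |x_h|, x) = x` off the axis. [folklore] -/
theorem collarChart_height {x : ℝ³} (hx : cylRadius x ≠ 0) :
    collarChart (1 - cylRadius x, x) = x := by
  simp only [collarChart, sub_sub_cancel, mul_inv_cancel₀ hx, one_smul, add_sub_cancel]

/-- The collar chart commutes with the axial translations (in the space variable). [folklore] -/
theorem collarChart_add_axialShift (t : ℝ) (y : ℝ³) (s : ℝ) :
    collarChart (t, y + 𝐯 s) = collarChart (t, y) + 𝐯 s := by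
  have hh : horizontalProjL (y + 𝐯 s) = horizontalProjL y := by
    rw [horizontalProjL_apply, horizontalProjL_apply, horizontalProj_add_axialShift]
  simp only [collarChart, cylRadius_add_axialShift, hh]
  abel

/-- The collar chart is `C^∞` off the axis. [folklore] -/
theorem contDiffAt_collarChart {p : ℝ × ℝ³} (hp : cylRadius p.2 ≠ 0) {n : WithTop ℕ∞} :
    ContDiffAt ℝ n collarChart p := by
  unfold collarChart
  have h1 : ContDiffAt ℝ n (fun q : ℝ × ℝ³ => cylRadius q.2) p :=
    (contDiffAt_cylRadius' hp).comp p contDiffAt_snd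
  have h2 : ContDiffAt ℝ n (fun q : ℝ × ℝ³ => (1 - q.1) * (cylRadius q.2)⁻¹) p :=
    (contDiffAt_const.sub contDiffAt_fst).mul (h1.inv hp)
  have h3 : ContDiffAt ℝ n (fun q : ℝ × ℝ³ => horizontalProjL q.2) p :=
    (horizontalProjL.contDiff.comp contDiff_snd).contDiffAt
  exact (h2.smul h3).add (contDiffAt_snd.sub h3)

/-- For `t ≤ 1` and `y` off the axis, `Φ(t, y)` lies in the closed cylinder iff `0 ≤ t`; in
particular the slab `[0, 1/2) × {|y_h| > 1/2}` is mapped into the closed cylinder. [folklore] -/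
theorem collarChart_mem_closure {p : ℝ × ℝ³} (hp : cylRadius p.2 ≠ 0) (h0 : 0 ≤ p.1) (h1 : p.1 ≤ 1) :
    collarChart p ∈ 𝕂 := by
  rw [closure_unitCylinder, mem_setOf_eq, cylRadius_collarChart hp, abs_of_nonneg (by linarith)]
  linarith

/-! ### Seeley's data on the slab -/

/-- The parameter set `B = {|y_h| > 1/2}` of the slab. [folklore] -/
def collarBase : Set ℝ³ := {y | 1 / 2 < cylRadius y}

/-- `B` is open. [folklore] -/
theorem isOpen_collarBase : IsOpen collarBase :=
  isOpen_lt continuous_const continuous_cylRadius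

/-- **Seeley's datum is smooth on the slab**: `f ∘ Φ` is `C^∞` on `[0, 1/2) × B` (within the slab)
if `f` is `C^∞` on the closed cylinder. [cite: Seeley1964, Theorem] -/
theorem contDiffOn_comp_collarChart {f : ℝ³ → F} (hf : ContDiffOn ℝ ∞ f 𝕂) :
    ContDiffOn ℝ ∞ (f ∘ collarChart) (Seeley.slab (1 / 2) collarBase) := by
  refine hf.comp (fun p hp => ?_) (fun p hp => ?_)
  · have hr : cylRadius p.2 ≠ 0 := by
      have : 1 / 2 < cylRadius p.2 := hp.2
      linarith
    exact (contDiffAt_collarChart hr).contDiffWithinAt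
  · obtain ⟨⟨h0, h1⟩, hB⟩ := hp
    have hr : cylRadius p.2 ≠ 0 := by
      have : 1 / 2 < cylRadius p.2 := hB
      linarith
    exact collarChart_mem_closure hr h0 (by linarith)

/-! ### Two pointwise facts about Seeley's operator: translation invariance and linearity -/

section SeeleyFacts

variable {E' : Type*} [NormedAddCommGroup E'] [NormedSpace ℝ E']

/-- Seeley's extension commutes with translations of the parameter: if `g(t, y + v) = g(t, y)`
for all `t, y`, then `E g (t, y + v) = E g (t, y)`. [folklore] -/
theorem seeley_extend_translate {δ : ℝ} {g : ℝ × E' → F} {v : E'}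
    (hg : ∀ t y, g (t, y + v) = g (t, y)) (t : ℝ) (y : E') :
    Seeley.extend δ g (t, y + v) = Seeley.extend δ g (t, y) := by
  unfold Seeley.extend
  by_cases ht : 0 ≤ t
  · rw [if_pos ht, if_pos ht, hg]
  · rw [if_neg ht, if_neg ht]
    refine tsum_congr fun k => ?_
    simp only [Seeley.term, Seeley.scale_apply, hg]

/-- Seeley's extension is additive (pointwise; below the hyperplane the series is a finite sum).
[folklore] -/
theorem seeley_extend_add {δ : ℝ} (hδ : 0 < δ) (g₁ g₂ : ℝ × E' → F) (p : ℝ × E') :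
    Seeley.extend δ (g₁ + g₂) p = Seeley.extend δ g₁ p + Seeley.extend δ g₂ p := by
  by_cases hp : 0 ≤ p.1
  · simp only [Seeley.extend_of_nonneg hp, Pi.add_apply]
  · have hp' : p.1 < 0 := not_le.1 hp
    obtain ⟨K, hK⟩ : ∃ K : ℕ, δ / (-p.1) ≤ 2 ^ K :=
      (pow_unbounded_of_one_lt (δ / (-p.1)) (by norm_num : (1 : ℝ) < 2)).imp fun _ h => h.le
    have hlt : p.1 < p.1 / 2 := by linarith
    rw [Seeley.extend_eq_sum_of_lt hδ hp' hK hlt, Seeley.extend_eq_sum_of_lt hδ hp' hK hlt,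
      Seeley.extend_eq_sum_of_lt hδ hp' hK hlt, ← sum_add_distrib]
    refine sum_congr rfl fun k _ => ?_
    simp only [Seeley.term, Pi.add_apply, smul_add]

/-- Seeley's extension is homogeneous (pointwise). [folklore] -/
theorem seeley_extend_smul {δ : ℝ} (hδ : 0 < δ) (c : ℝ) (g : ℝ × E' → F) (p : ℝ × E') :
    Seeley.extend δ (c • g) p = c • Seeley.extend δ g p := by
  by_cases hp : 0 ≤ p.1
  · simp only [Seeley.extend_of_nonneg hp, Pi.smul_apply]
  · have hp' : p.1 < 0 := not_le.1 hp
    obtain ⟨K, hK⟩ : ∃ K : ℕ, δ / (-p.1) ≤ 2 ^ K :=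
      (pow_unbounded_of_one_lt (δ / (-p.1)) (by norm_num : (1 : ℝ) < 2)).imp fun _ h => h.le
    have hlt : p.1 < p.1 / 2 := by linarith
    rw [Seeley.extend_eq_sum_of_lt hδ hp' hK hlt, Seeley.extend_eq_sum_of_lt hδ hp' hK hlt, smul_sum]
    refine sum_congr rfl fun k _ => ?_
    simp only [Seeley.term, Pi.smul_apply, smul_comm c]

end SeeleyFacts

/-! ### The raw extension: glue `f` inside with Seeley's reflection outside -/

/-- **The raw radial Seeley extension**: `f` on the closed cylinder, and
`E(f ∘ Φ)(1 - |x_h|, x)` outside (Seeley's operator with `δ = 1/2` in the radial variable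
`t = 1 - r`). [cite: Seeley1964, Theorem] -/
def rawExtend (f : ℝ³ → F) (x : ℝ³) : F :=
  if cylRadius x ≤ 1 then f x else Seeley.extend (1 / 2 : ℝ) (f ∘ collarChart) (1 - cylRadius x, x)

/-- `rawExtend f = f` on the closed cylinder. [folklore] -/
theorem rawExtend_of_le {f : ℝ³ → F} {x : ℝ³} (hx : cylRadius x ≤ 1) : rawExtend f x = f x :=
  if_pos hx

/-- `rawExtend f = f` on `𝕂`. [folklore] -/
theorem rawExtend_of_mem_closure {f : ℝ³ → F} {x : ℝ³} (hx : x ∈ 𝕂) : rawExtend f x = f x :=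
  rawExtend_of_le (by rwa [closure_unitCylinder] at hx)

/-- On `{|x_h| > 1/2}` the raw extension is `E(f ∘ Φ)(1 - |x_h|, x)` (also for `r ≤ 1`, where
both are `f x` since `Φ(1 - |x_h|, x) = x`). [folklore] -/
theorem rawExtend_eq_extend {f : ℝ³ → F} {x : ℝ³} (hx : 1 / 2 < cylRadius x) :
    rawExtend f x = Seeley.extend (1 / 2 : ℝ) (f ∘ collarChart) (1 - cylRadius x, x) := by
  by_cases h : cylRadius x ≤ 1
  · rw [rawExtend_of_le h, Seeley.extend_of_nonneg (show (0 : ℝ) ≤ (1 - cylRadius x, x).1 by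
      simp only; linarith)]
    simp only [comp_apply, collarChart_height (show cylRadius x ≠ 0 by linarith)]
  · exact if_neg h

/-- **The raw extension is smooth** if `f` is `C^∞` on the closed cylinder: inside it is `f`,
on `{|x_h| > 1/2}` it is the composite of Seeley's smooth extension with the smooth map
`x ↦ (1 - |x_h|, x)`. [cite: Seeley1964, Theorem] -/
theorem contDiff_rawExtend [CompleteSpace F] {f : ℝ³ → F} (hf : ContDiffOn ℝ ∞ f 𝕂) :
    ContDiff ℝ ∞ (rawExtend f) := by
  have hG : ContDiffOn ℝ ∞ (Seeley.extend (1 / 2 : ℝ) (f ∘ collarChart)) (Iio (1 / 2 : ℝ) ×ˢ collarBase) :=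
    Seeley.contDiffOn_extend (by norm_num) isOpen_collarBase (contDiffOn_comp_collarChart hf)
  refine contDiff_iff_contDiffAt.2 fun x => ?_
  by_cases hx : cylRadius x < 1
  · -- inside: `rawExtend f = f` near `x`
    have hev : rawExtend f =ᶠ[𝓝 x] f := by
      filter_upwards [unitCylinder.isOpen.mem_nhds (show x ∈ (unitCylinder : Set ℝ³) from hx)] with y hy
      exact rawExtend_of_le (le_of_lt hy)
    refine ContDiffAt.congr_of_eventuallyEq ?_ hev
    exact hf.contDiffAt (mem_of_superset (unitCylinder.isOpen.mem_nhds hx) subset_closure)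
  · -- outside `{r ≥ 1}`: composite with Seeley's extension on the open set `{r > 1/2}`
    have hx' : 1 / 2 < cylRadius x := by linarith [not_lt.1 hx]
    have hψ : ContDiffAt ℝ ∞ (fun y : ℝ³ => ((1 : ℝ) - cylRadius y, y)) x :=
      (contDiffAt_const.sub (contDiffAt_cylRadius' (by linarith))).prodMk contDiffAt_id
    have hmem : ((1 : ℝ) - cylRadius x, x) ∈ Iio (1 / 2 : ℝ) ×ˢ collarBase :=
      ⟨by simp only [Set.mem_Iio]; linarith, hx'⟩
    have hGa : ContDiffAt ℝ ∞ (Seeley.extend (1 / 2 : ℝ) (f ∘ collarChart)) ((1 : ℝ) - cylRadius x, x) :=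
      hG.contDiffAt ((isOpen_Iio.prod isOpen_collarBase).mem_nhds hmem)
    have hcomp : ContDiffAt ℝ ∞ (Seeley.extend (1 / 2 : ℝ) (f ∘ collarChart) ∘ fun y : ℝ³ =>
        ((1 : ℝ) - cylRadius y, y)) x :=
      ContDiffAt.comp (f := fun y : ℝ³ => ((1 : ℝ) - cylRadius y, y)) x hGa hψ
    have hev : rawExtend f =ᶠ[𝓝 x] (Seeley.extend (1 / 2 : ℝ) (f ∘ collarChart) ∘ fun y : ℝ³ =>
        ((1 : ℝ) - cylRadius y, y)) := by
      filter_upwards [isOpen_collarBase.mem_nhds hx'] with y hy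
      exact rawExtend_eq_extend hy
    exact hcomp.congr_of_eventuallyEq hev

/-- The raw extension of an `L`-periodic function is `L`-periodic. [folklore] -/
theorem rawExtend_add_axialShift {f : ℝ³ → F} (hf : IsAxiallyPeriodic L f) (x : ℝ³) :
    rawExtend f (x + 𝐯 L) = rawExtend f x := by
  unfold rawExtend
  rw [cylRadius_add_axialShift]
  split_ifs with h
  · exact hf x
  · have hg : ∀ t y, (f ∘ collarChart) (t, y + 𝐯 L) = (f ∘ collarChart) (t, y) := fun t y => by
      simp only [comp_apply, collarChart_add_axialShift, hf _]
    exact seeley_extend_translate hg _ _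

/-- The raw extension is additive. [folklore] -/
theorem rawExtend_add (f g : ℝ³ → F) (x : ℝ³) :
    rawExtend (f + g) x = rawExtend f x + rawExtend g x := by
  unfold rawExtend
  split_ifs with h
  · rfl
  · rw [show (f + g) ∘ collarChart = f ∘ collarChart + g ∘ collarChart from rfl]
    exact seeley_extend_add (by norm_num) _ _ _

/-- The raw extension is homogeneous. [folklore] -/
theorem rawExtend_smul (c : ℝ) (f : ℝ³ → F) (x : ℝ³) :
    rawExtend (c • f) x = c • rawExtend f x := by
  unfold rawExtend
  split_ifs with h
  · rfl
  · rw [show (c • f) ∘ collarChart = c • (f ∘ collarChart) from rfl]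
    exact seeley_extend_smul (by norm_num) _ _ _

/-! ### The reflection formula on the collar -/

/-- **The radial reflections** `R_k x = (1 - 2^k (r - 1)) x_h / r + x_v` (`r = |x_h|`): the point
on the ray of `x` at radius `1 - 2^k (r - 1)`, i.e. `Φ(2^k (r - 1), x)`. [cite: Seeley1964, Theorem] -/
def radialReflect (k : ℕ) (x : ℝ³) : ℝ³ :=
  collarChart ((2 : ℝ) ^ k * (cylRadius x - 1), x)

/-- The reflection in coordinates. [folklore] -/
theorem radialReflect_eq (k : ℕ) (x : ℝ³) :
    radialReflect k x = ((1 - (2 : ℝ) ^ k * (cylRadius x - 1)) * (cylRadius x)⁻¹) • horizontalProjL x +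
      (x - horizontalProjL x) := rfl

/-- The radius of the reflected point is `1 - 2^k (r - 1)` as long as this is nonnegative.
[folklore] -/
theorem cylRadius_radialReflect {k : ℕ} {x : ℝ³} (hx : cylRadius x ≠ 0)
    (h : (2 : ℝ) ^ k * (cylRadius x - 1) ≤ 1) :
    cylRadius (radialReflect k x) = 1 - (2 : ℝ) ^ k * (cylRadius x - 1) := by
  rw [radialReflect, cylRadius_collarChart (by exact hx), abs_of_nonneg (by simp only; linarith)]

/-- Outside the cylinder the reflected point lies strictly inside: for `r > 1` and
`2^k (r - 1) ≤ 1`, `|R_k x|_h < 1`. [folklore] -/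
theorem cylRadius_radialReflect_lt_one {k : ℕ} {x : ℝ³} (hx : 1 < cylRadius x)
    (h : (2 : ℝ) ^ k * (cylRadius x - 1) ≤ 1) : cylRadius (radialReflect k x) < 1 := by
  rw [cylRadius_radialReflect (by linarith) h]
  have : (0 : ℝ) < (2 : ℝ) ^ k * (cylRadius x - 1) := mul_pos (by positivity) (by linarith)
  linarith

/-- The reflections commute with the axial translations. [folklore] -/
theorem radialReflect_add_axialShift (k : ℕ) (x : ℝ³) (s : ℝ) :
    radialReflect k (x + 𝐯 s) = radialReflect k x + 𝐯 s := by
  rw [radialReflect, radialReflect, cylRadius_add_axialShift, collarChart_add_axialShift]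

/-- The height coordinate is unchanged by the reflections. [folklore] -/
theorem radialReflect_apply_two (k : ℕ) (x : ℝ³) : radialReflect k x 2 = x 2 :=
  collarChart_apply_two _

/-- **The `k`-th term of Seeley's series in the radial variable** is
`w_k(1 - r) • f(R_k x)`. [cite: Seeley1964, Theorem] -/
theorem seeley_term_eq (f : ℝ³ → F) (k : ℕ) (x : ℝ³) :
    Seeley.term (1 / 2 : ℝ) (f ∘ collarChart) k (1 - cylRadius x, x) =
      Seeley.weight (1 / 2 : ℝ) k (1 - cylRadius x) • f (radialReflect k x) := by
  simp only [Seeley.term, Seeley.scale_apply, comp_apply, radialReflect]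
  congr 2
  ring_nf

/-- **Reflection formula**: outside the cylinder, `rawExtend f x = ∑_k w_k(1 - r) f(R_k x)`.
[cite: Seeley1964, Theorem] -/
theorem rawExtend_of_one_lt {f : ℝ³ → F} {x : ℝ³} (hx : 1 < cylRadius x) :
    rawExtend f x = ∑' k, Seeley.weight (1 / 2 : ℝ) k (1 - cylRadius x) • f (radialReflect k x) := by
  rw [rawExtend, if_neg (not_le.2 hx), Seeley.extend_of_neg (show ((1 : ℝ) - cylRadius x, x).1 < 0 by
    simp only; linarith)]
  exact tsum_congr fun k => seeley_term_eq f k x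

/-- Seeley's weight `w_k(1 - r)` vanishes once `2^k (r - 1) ≥ 1/4`. [folklore] -/
theorem seeley_weight_eq_zero {k : ℕ} {x : ℝ³} (h : 1 / 4 ≤ (2 : ℝ) ^ k * (cylRadius x - 1)) :
    Seeley.weight (1 / 2 : ℝ) k (1 - cylRadius x) = 0 := by
  apply Seeley.weight_eq_zero
  rw [div_le_iff₀ (by norm_num : (0 : ℝ) < 1 / 2)]
  linarith

/-- Where the weight `w_k(1 - r)` is nonzero (`r > 1`), `2^k (r - 1) < 1/4`, so the reflected
point has radius in `(3/4, 1)`. [folklore] -/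
theorem lt_of_seeley_weight_ne_zero {k : ℕ} {x : ℝ³}
    (h : Seeley.weight (1 / 2 : ℝ) k (1 - cylRadius x) ≠ 0) :
    (2 : ℝ) ^ k * (cylRadius x - 1) < 1 / 4 := by
  by_contra h'
  exact h (seeley_weight_eq_zero (not_lt.1 h'))

/-- A threshold index `K(η)` with `2^K η ≥ 1/4`: beyond it all weights vanish on `{r ≥ 1 + η}`.
[folklore] -/
theorem exists_pow_mul_ge (η : ℝ) (hη : 0 < η) : ∃ K : ℕ, 1 / 4 ≤ (2 : ℝ) ^ K * η := by
  obtain ⟨K, hK⟩ := pow_unbounded_of_one_lt (1 / (4 * η)) (by norm_num : (1 : ℝ) < 2)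
  refine ⟨K, ?_⟩
  rw [div_lt_iff₀ (by positivity)] at hK
  linarith

/-- **Finite reflection formula** on `{r ≥ 1 + η}`: if `2^K η ≥ 1/4` then
`rawExtend f x = ∑_{k < K} w_k(1 - r) f(R_k x)` there. [cite: Seeley1964, Theorem] -/
theorem rawExtend_eq_sum {f : ℝ³ → F} {η : ℝ} (hη : 0 < η) {K : ℕ} (hK : 1 / 4 ≤ (2 : ℝ) ^ K * η)
    {x : ℝ³} (hx : 1 + η ≤ cylRadius x) :
    rawExtend f x = ∑ k ∈ range K, Seeley.weight (1 / 2 : ℝ) k (1 - cylRadius x) • f (radialReflect k x) := by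
  rw [rawExtend_of_one_lt (by linarith)]
  refine tsum_eq_sum fun k hk => ?_
  simp only [Finset.mem_range, not_lt] at hk
  rw [seeley_weight_eq_zero, zero_smul]
  have h2 : (2 : ℝ) ^ K ≤ (2 : ℝ) ^ k := pow_le_pow_right₀ (by norm_num) hk
  have h3 : (2 : ℝ) ^ K * η ≤ (2 : ℝ) ^ k * (cylRadius x - 1) :=
    mul_le_mul h2 (by linarith) hη.le (by positivity)
  linarith

/-- Each summand of the finite reflection formula is smooth on the open collar `{r > 1}` when `f`
is `C^∞` on the closed cylinder (the reflected point lies in the open cylinder wherever the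
weight does not vanish identically nearby). [folklore] -/
theorem contDiffAt_weight_smul_reflect {f : ℝ³ → F} (hf : ContDiffOn ℝ ∞ f 𝕂) (k : ℕ) {x : ℝ³}
    (hx : 1 < cylRadius x) :
    ContDiffAt ℝ ∞ (fun y => Seeley.weight (1 / 2 : ℝ) k (1 - cylRadius y) • f (radialReflect k y)) x := by
  have hr : ContDiffAt ℝ ∞ cylRadius x := contDiffAt_cylRadius' (by linarith)
  have hw : ContDiffAt ℝ ∞ (fun y => Seeley.weight (1 / 2 : ℝ) k (1 - cylRadius y)) x :=
    (Seeley.contDiff_weight (1 / 2 : ℝ) k).contDiffAt.comp x (contDiffAt_const.sub hr)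
  by_cases h : (2 : ℝ) ^ k * (cylRadius x - 1) < 1 / 2
  · -- the reflected point is in the open cylinder, where `f` is smooth
    set c : ℝ := (2 : ℝ) ^ k with hc
    have hg : ContDiffAt ℝ ∞ (fun y : ℝ³ => (c * (cylRadius y - 1), y)) x :=
      (contDiffAt_const.mul (hr.sub contDiffAt_const)).prodMk contDiffAt_id
    have hx0 : cylRadius x ≠ 0 := by linarith
    have hΦ : ContDiffAt ℝ ∞ collarChart (c * (cylRadius x - 1), x) := contDiffAt_collarChart hx0
    have hR : ContDiffAt ℝ ∞ (radialReflect k) x := by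
      have hdef : radialReflect k = collarChart ∘ fun y : ℝ³ => (c * (cylRadius y - 1), y) := rfl
      rw [hdef]
      exact ContDiffAt.comp (f := fun y : ℝ³ => (c * (cylRadius y - 1), y)) x hΦ hg
    have hmem : radialReflect k x ∈ (unitCylinder : Set ℝ³) :=
      cylRadius_radialReflect_lt_one hx (by linarith)
    have hfa : ContDiffAt ℝ ∞ f (radialReflect k x) :=
      hf.contDiffAt (mem_of_superset (unitCylinder.isOpen.mem_nhds hmem) subset_closure)
    exact hw.smul (hfa.comp x hR)
  · -- the weight vanishes identically near `x`
    have h' : 1 / 2 ≤ (2 : ℝ) ^ k * (cylRadius x - 1) := not_lt.1 h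
    have ho : IsOpen {y : ℝ³ | 1 / 4 < (2 : ℝ) ^ k * (cylRadius y - 1)} :=
      isOpen_lt continuous_const (continuous_const.mul (continuous_cylRadius.sub continuous_const))
    have hev : (fun y => Seeley.weight (1 / 2 : ℝ) k (1 - cylRadius y) • f (radialReflect k y)) =ᶠ[𝓝 x]
        fun _ => 0 := by
      filter_upwards [ho.mem_nhds (show 1 / 4 < (2 : ℝ) ^ k * (cylRadius x - 1) by linarith)] with y hy
      rw [seeley_weight_eq_zero hy.le, zero_smul]
    exact contDiffAt_const.congr_of_eventuallyEq hev

/-! ### The extension operator -/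

/-- **The periodic radial Seeley extension operator** `cylExtend f = χ · rawExtend f`, with the
radial cutoff `χ = cylRadialCutoff (9/8) (5/4)` (`χ = 1` on `{r ≤ 9/8}`, `χ = 0` on `{r ≥ 5/4}`).
[cite: Seeley1964, Theorem] -/
def cylExtend (f : ℝ³ → F) (x : ℝ³) : F :=
  cylRadialCutoff (9 / 8) (5 / 4) x • rawExtend f x

/-- **`cylExtend f = f` on the closed cylinder.** [cite: Seeley1964, Theorem] -/
theorem cylExtend_of_le_one {f : ℝ³ → F} {x : ℝ³} (hx : cylRadius x ≤ 1) : cylExtend f x = f x := by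
  rw [cylExtend, rawExtend_of_le hx, cylRadialCutoff_eq_one (by norm_num) (by norm_num) (by linarith),
    one_smul]

/-- `cylExtend f = f` on `𝕂`. [folklore] -/
theorem cylExtend_of_mem_closure {f : ℝ³ → F} {x : ℝ³} (hx : x ∈ 𝕂) : cylExtend f x = f x :=
  cylExtend_of_le_one (by rwa [closure_unitCylinder] at hx)

/-- `cylExtend f` and `f` agree on the closed cylinder (as an `EqOn`). [folklore] -/
theorem eqOn_cylExtend (f : ℝ³ → F) : EqOn (cylExtend f) f 𝕂 := fun _ hx => cylExtend_of_mem_closure hx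

/-- **`cylExtend f` vanishes on `{r ≥ 5/4}`.** [folklore] -/
theorem cylExtend_eq_zero {f : ℝ³ → F} {x : ℝ³} (hx : 5 / 4 ≤ cylRadius x) : cylExtend f x = 0 := by
  rw [cylExtend, cylRadialCutoff_eq_zero (by norm_num) (by norm_num) hx, zero_smul]

/-- On `{r ≤ 9/8}` the cutoff is invisible: `cylExtend f = rawExtend f`. [folklore] -/
theorem cylExtend_of_le {f : ℝ³ → F} {x : ℝ³} (hx : cylRadius x ≤ 9 / 8) : cylExtend f x = rawExtend f x := by
  rw [cylExtend, cylRadialCutoff_eq_one (by norm_num) (by norm_num) hx, one_smul]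

/-- **`cylExtend f` is `C^∞` on `ℝ³`** if `f` is `C^∞` on the closed cylinder. [cite: Seeley1964, Theorem] -/
theorem contDiff_cylExtend [CompleteSpace F] {f : ℝ³ → F} (hf : ContDiffOn ℝ ∞ f 𝕂) :
    ContDiff ℝ ∞ (cylExtend f) :=
  (contDiff_cylRadialCutoff _ _).smul (contDiff_rawExtend hf)

/-- **`cylExtend f` is `L`-periodic in `z`** if `f` is. [folklore] -/
theorem isAxiallyPeriodic_cylExtend {f : ℝ³ → F} (hf : IsAxiallyPeriodic L f) :
    IsAxiallyPeriodic L (cylExtend f) := fun x => by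
  simp only [cylExtend, rawExtend_add_axialShift hf, (isAxiallyPeriodic_cylRadialCutoff L _ _) x]

/-- The extension of a smooth periodic function is smooth on `ℝ³` and periodic. [folklore] -/
theorem smooth_periodic_cylExtend [CompleteSpace F] {f : ℝ³ → F} (hf : IsSmoothPeriodic L f) :
    ContDiff ℝ ∞ (cylExtend f) ∧ IsAxiallyPeriodic L (cylExtend f) :=
  ⟨contDiff_cylExtend hf.smooth, isAxiallyPeriodic_cylExtend hf.periodic⟩

/-- The extension of a smooth periodic function is in particular smooth periodic on the closed
cylinder (where it is `f`). [folklore] -/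
theorem isSmoothPeriodic_cylExtend [CompleteSpace F] {f : ℝ³ → F} (hf : IsSmoothPeriodic L f) :
    IsSmoothPeriodic L (cylExtend f) :=
  ⟨(contDiff_cylExtend hf.smooth).contDiffOn, isAxiallyPeriodic_cylExtend hf.periodic⟩

/-- **Linearity**: `cylExtend (f + g) = cylExtend f + cylExtend g`. [folklore] -/
theorem cylExtend_add (f g : ℝ³ → F) : cylExtend (f + g) = cylExtend f + cylExtend g := by
  funext x
  simp only [cylExtend, rawExtend_add, Pi.add_apply, smul_add]

/-- **Linearity**: `cylExtend (c • f) = c • cylExtend f`. [folklore] -/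
theorem cylExtend_smul (c : ℝ) (f : ℝ³ → F) : cylExtend (c • f) = c • cylExtend f := by
  funext x
  simp only [cylExtend, rawExtend_smul, Pi.smul_apply, smul_comm c]

/-- `cylExtend 0 = 0`. [folklore] -/
theorem cylExtend_zero : cylExtend (0 : ℝ³ → F) = 0 := by
  have h := cylExtend_smul (0 : ℝ) (0 : ℝ³ → F)
  rwa [zero_smul, zero_smul] at h

/-- `cylExtend (f - g) = cylExtend f - cylExtend g`. [folklore] -/
theorem cylExtend_sub (f g : ℝ³ → F) : cylExtend (f - g) = cylExtend f - cylExtend g := by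
  rw [sub_eq_add_neg, cylExtend_add, show -g = (-1 : ℝ) • g by simp, cylExtend_smul]
  simp [sub_eq_add_neg]

/-- The extension operator as a real-linear map on functions. [folklore] -/
def cylExtendₗ : (ℝ³ → F) →ₗ[ℝ] (ℝ³ → F) where
  toFun := cylExtend
  map_add' := cylExtend_add
  map_smul' := cylExtend_smul

/-- `cylExtendₗ f = cylExtend f`. [folklore] -/
@[simp] theorem cylExtendₗ_apply (f : ℝ³ → F) : cylExtendₗ f = cylExtend f := rfl

/-- The support of `cylExtend f` lies in `{r < 5/4}`. [folklore] -/
theorem cylRadius_lt_of_cylExtend_ne_zero {f : ℝ³ → F} {x : ℝ³} (hx : cylExtend f x ≠ 0) :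
    cylRadius x < 5 / 4 := by
  by_contra h
  exact hx (cylExtend_eq_zero (not_lt.1 h))

/-- **Reflection formula for the extension operator** on `{1 + η ≤ r}` (`η > 0`, `2^K η ≥ 1/4`):
`cylExtend f x = χ(x) ∑_{k<K} w_k(1 - r) f(R_k x)`. [cite: Seeley1964, Theorem] -/
theorem cylExtend_eq_sum {f : ℝ³ → F} {η : ℝ} (hη : 0 < η) {K : ℕ} (hK : 1 / 4 ≤ (2 : ℝ) ^ K * η)
    {x : ℝ³} (hx : 1 + η ≤ cylRadius x) :
    cylExtend f x = cylRadialCutoff (9 / 8) (5 / 4) x •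
      ∑ k ∈ range K, Seeley.weight (1 / 2 : ℝ) k (1 - cylRadius x) • f (radialReflect k x) := by
  rw [cylExtend, rawExtend_eq_sum hη hK hx]

end PeriodicCylinder

end Literature.Analysis.FluidPDE
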